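import Literature.Geometry.Riemannian.BakryEmeryHeatFlow
import Literature.Geometry.Lorentzian.CurvatureNaturality
import HarnessLib

/-!
# A chart of the maximal atlas as a local isometry (any dimension)

`AtlasChartMetric.lean` transports a metric on a Riemannian `3`-manifold to the target of a chart
`ψ` of the **maximal** `C^∞` atlas along the inverse chart. This file is the same construction for a
manifold modelled on an arbitrary finite-dimensional real normed space `E` (boundaryless model
`𝓘(ℝ, E)`), together with the reading of the intrinsic operators in such a chart — the form in
which the Morse charts of the Gauss–Bonnet argument (which are charts of the maximal atlas, not of
the atlas of the charted space) are used:

* `MaxAtlasChart.inv ψ : ψ.target → X`, smooth with invertible differential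
  (`contMDiff_inv`, `injective_mfderiv_inv`, `mfderiv_chart_comp_inv_apply`);
* `MaxAtlasChart.metric g hψ = Ψ^* g` (`PseudoRiemannianMetric.comap`) with representative
  `metricRepr` (`metric_val_eq_repr`, `isMetricOn_metricRepr`);
* the bridges `scalarCurvature_inv_eq`, `dalembertian_inv_eq`, `innerDual_inv_eq`,
  `gradSq_inv_eq`: at `Ψ p` the scalar curvature, the Laplace–Beltrami operator, the pairing of
  differentials and the gradient square of `g` are the coordinate objects (`MetricCoord.scalAt`,
  `lapAt`, `sharpAt`-pairing, `gradSqAt`) of the representative at `p`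
  (O'Neill 1983, Ch. 3, Prop. 3.59: local isometries preserve the connection and curvature;
  the tree's `scalarCurvature_comap`, `dalembertian_comap`, `innerDual_mvfderiv_comp`).

Everything is proved; no named facts.

## References

* B. O'Neill, *Semi-Riemannian geometry with applications to relativity*, Academic Press 1983,
  Ch. 3, Prop. 3.59 and pp. 90–91. [ONeill1983]
-/

noncomputable section

open Bundle Set Function Filter TopologicalSpace Manifold
open scoped Manifold ContDiff Topology

namespace Literature.Geometry.Lorentzian

namespace MaxAtlasChart

variable {E : Type*} [NormedAddCommGroup E] [NormedSpace ℝ E]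
  {X : Type*} [TopologicalSpace X] {ψ : OpenPartialHomeomorph X E}

/-! ### The chart target and the inverse chart -/

variable (ψ) in
/-- The target of the chart `ψ` as an open submanifold of `E`. [folklore] -/
abbrev target : Opens E :=
  ⟨ψ.target, ψ.open_target⟩

variable (ψ) in
/-- The inverse chart `Ψ : ψ.target → X`, `Ψ p = ψ⁻¹ p`, from the open submanifold `ψ.target`.
[folklore] -/
def inv : target ψ → X :=
  fun p ↦ ψ.symm p

omit [NormedSpace ℝ E] in
/-- Unfolding lemma: `inv ψ p = ψ⁻¹ p`. [folklore] -/
@[simp]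
lemma inv_apply (p : target ψ) : inv ψ p = ψ.symm p := rfl

omit [NormedSpace ℝ E] in
/-- The inverse chart lands in the chart source. [folklore] -/
lemma inv_mem_source (p : target ψ) : inv ψ p ∈ ψ.source :=
  ψ.map_target p.2

omit [NormedSpace ℝ E] in
/-- `ψ (ψ⁻¹ p) = p` on the target. [folklore] -/
@[simp]
lemma apply_inv (p : target ψ) : ψ (inv ψ p) = p :=
  ψ.right_inv p.2

variable [ChartedSpace E X]

/-- A chart of the maximal `C^∞` atlas is differentiable with differentiable inverse. [folklore] -/
theorem mdifferentiable_chart (hψ : ψ ∈ IsManifold.maximalAtlas 𝓘(ℝ, E) ∞ X) :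
    ψ.MDifferentiable 𝓘(ℝ, E) 𝓘(ℝ, E) :=
  ⟨(contMDiffOn_of_mem_maximalAtlas hψ).mdifferentiableOn (by simp),
    (contMDiffOn_symm_of_mem_maximalAtlas hψ).mdifferentiableOn (by simp)⟩

/-- The inverse chart is smooth (`C^{∞ + 1} = C^∞`). [folklore] -/
theorem contMDiff_inv (hψ : ψ ∈ IsManifold.maximalAtlas 𝓘(ℝ, E) ∞ X) :
    ContMDiff 𝓘(ℝ, E) 𝓘(ℝ, E) (∞ + 1) (inv ψ) := by
  have h : ((∞ : ℕ∞ω) + 1) = ∞ := rfl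
  rw [h]
  exact (contMDiffOn_symm_of_mem_maximalAtlas hψ).comp_contMDiff contMDiff_subtype_val
    fun p ↦ p.2

/-- The inverse chart is smooth of class `C^∞`. [folklore] -/
theorem contMDiff_inv' (hψ : ψ ∈ IsManifold.maximalAtlas 𝓘(ℝ, E) ∞ X) :
    ContMDiff 𝓘(ℝ, E) 𝓘(ℝ, E) ∞ (inv ψ) :=
  (contMDiff_inv hψ).of_le le_self_add

/-- The differential of the inverse chart from the open submanifold is the differential of
`ψ.symm`. [folklore] -/
theorem mfderiv_inv (hψ : ψ ∈ IsManifold.maximalAtlas 𝓘(ℝ, E) ∞ X) (p : target ψ) :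
    mfderiv 𝓘(ℝ, E) 𝓘(ℝ, E) (inv ψ) p = mfderiv 𝓘(ℝ, E) 𝓘(ℝ, E) ψ.symm (p : E) :=
  mfderiv_comp_subtypeVal (f := ψ.symm) ((mdifferentiable_chart hψ).symm.mdifferentiableAt p.2)

/-- The differential of the inverse chart is invertible. [folklore] -/
theorem isInvertible_mfderiv_inv (hψ : ψ ∈ IsManifold.maximalAtlas 𝓘(ℝ, E) ∞ X) (p : target ψ) :
    (mfderiv 𝓘(ℝ, E) 𝓘(ℝ, E) (inv ψ) p).IsInvertible := by
  rw [mfderiv_inv hψ]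
  exact ⟨(mdifferentiable_chart hψ).symm.mfderiv p.2, rfl⟩

/-- The differential of the inverse chart is injective. [folklore] -/
theorem injective_mfderiv_inv (hψ : ψ ∈ IsManifold.maximalAtlas 𝓘(ℝ, E) ∞ X) :
    ∀ p : target ψ, Function.Injective (mfderiv 𝓘(ℝ, E) 𝓘(ℝ, E) (inv ψ) p) := fun p ↦ by
  rw [mfderiv_inv hψ]
  exact (mdifferentiable_chart hψ).symm.mfderiv_injective p.2

/-- `dψ ∘ dΨ = id` at the points of the target. [folklore] -/
theorem mfderiv_chart_comp_inv_apply (hψ : ψ ∈ IsManifold.maximalAtlas 𝓘(ℝ, E) ∞ X)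
    (p : target ψ) (a : E) :
    mfderiv 𝓘(ℝ, E) 𝓘(ℝ, E) ψ (inv ψ p) (mfderiv 𝓘(ℝ, E) 𝓘(ℝ, E) (inv ψ) p a) = a := by
  rw [mfderiv_inv hψ]
  have hd := mdifferentiable_chart hψ
  have h1 : mfderiv 𝓘(ℝ, E) 𝓘(ℝ, E) (ψ ∘ ψ.symm) (p : E) =
      (mfderiv 𝓘(ℝ, E) 𝓘(ℝ, E) ψ (ψ.symm p)).comp (mfderiv 𝓘(ℝ, E) 𝓘(ℝ, E) ψ.symm (p : E)) :=
    mfderiv_comp (p : E) (hd.mdifferentiableAt (ψ.map_target p.2)) (hd.symm.mdifferentiableAt p.2)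
  have h2 : mfderiv 𝓘(ℝ, E) 𝓘(ℝ, E) (ψ ∘ ψ.symm) (p : E) = ContinuousLinearMap.id ℝ E := by
    have hev : (ψ ∘ ψ.symm) =ᶠ[𝓝 (p : E)] id := by
      filter_upwards [ψ.open_target.mem_nhds p.2] with z hz
      exact ψ.right_inv hz
    rw [hev.mfderiv_eq]
    exact mfderiv_id
  have h3 := congrArg (fun L : E →L[ℝ] E ↦ L a) (h1.symm.trans h2)
  simp only [ContinuousLinearMap.id_apply] at h3
  exact h3

variable [FiniteDimensional ℝ E] [IsManifold 𝓘(ℝ, E) ∞ X]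

/-! ### The transported metric on the chart target -/

variable (g : PseudoRiemannianMetric 𝓘(ℝ, E) ∞ E (TangentSpace 𝓘(ℝ, E) : X → Type _))

/-- **The metric transported to the chart target**: `Ψ^* g` on the open submanifold `ψ.target`
(`PseudoRiemannianMetric.comap` along `Ψ = inv ψ`). O'Neill 1983, Ch. 3, pp. 90–91.
[cite: ONeill1983, Ch. 3, pp. 90–91] -/
abbrev metric (hψ : ψ ∈ IsManifold.maximalAtlas 𝓘(ℝ, E) ∞ X) :
    PseudoRiemannianMetric 𝓘(ℝ, E) ∞ E (TangentSpace 𝓘(ℝ, E) : target ψ → Type _) :=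
  g.comap PseudoRiemannianMetric.contMDiff_pullbackBilin_holds (inv ψ) (contMDiff_inv hψ)
    (injective_mfderiv_inv hψ) rfl

/-- `(Ψ^* g)_p(a, b) = g_{Ψ p}(dΨ_p a, dΨ_p b)`. [cite: ONeill1983, Ch. 3, pp. 90–91] -/
@[simp]
theorem metric_val (hψ : ψ ∈ IsManifold.maximalAtlas 𝓘(ℝ, E) ∞ X) (p : target ψ) (a b : E) :
    (metric g hψ).val p a b =
      g.val (ψ.symm p) (mfderiv 𝓘(ℝ, E) 𝓘(ℝ, E) (inv ψ) p a)
        (mfderiv 𝓘(ℝ, E) 𝓘(ℝ, E) (inv ψ) p b) :=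
  rfl

/-- The transported metric of a Riemannian metric is Riemannian. [folklore] -/
theorem isRiemannian_metric (hψ : ψ ∈ IsManifold.maximalAtlas 𝓘(ℝ, E) ∞ X) (hg : g.IsRiemannian) :
    (metric g hψ).IsRiemannian := fun p a ha ↦ by
  rw [metric_val]
  exact hg _ _ fun h0 ↦ ha (injective_mfderiv_inv hψ p (h0.trans (map_zero _).symm))

/-- The representative of the transported metric on all of `E` (junk `0` off the target).
[folklore] -/
def metricRepr (hψ : ψ ∈ IsManifold.maximalAtlas 𝓘(ℝ, E) ∞ X) : E → E →L[ℝ] E →L[ℝ] ℝ :=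
  fun p ↦ by
    classical
    exact if hp : p ∈ ψ.target then (metric g hψ).val ⟨p, hp⟩ else 0

/-- The representative represents: `(Ψ^* g).val p = metricRepr p` on the target. [folklore] -/
theorem metric_val_eq_repr (hψ : ψ ∈ IsManifold.maximalAtlas 𝓘(ℝ, E) ∞ X) :
    ∀ p : target ψ, (metric g hψ).val p = metricRepr g hψ p := fun p ↦ by
  have hp : (p : E) ∈ ψ.target := p.2
  simp only [metricRepr, dif_pos hp]

/-- The representative is smooth, symmetric and nondegenerate on the target. [folklore] -/
theorem isMetricOn_metricRepr (hψ : ψ ∈ IsManifold.maximalAtlas 𝓘(ℝ, E) ∞ X) :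
    MetricCoord.IsMetricOn (metricRepr g hψ) ψ.target :=
  OpensChart.isMetricOn_repr (U := target ψ) (metric_val_eq_repr g hψ)

/-! ### Reading the intrinsic operators in the chart -/

variable [CompleteSpace E]

omit [FiniteDimensional ℝ E] [IsManifold 𝓘(ℝ, E) ∞ X] [CompleteSpace E] in
/-- The representative `F ∘ ψ⁻¹` of a function differentiable at `Ψ p` is differentiable at `p`.
[folklore] -/
theorem differentiableAt_comp_symm (hψ : ψ ∈ IsManifold.maximalAtlas 𝓘(ℝ, E) ∞ X) (p : target ψ)
    {F : X → ℝ} (hF : MDifferentiableAt 𝓘(ℝ, E) 𝓘(ℝ, ℝ) F (ψ.symm p)) :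
    DifferentiableAt ℝ (F ∘ ψ.symm) (p : E) :=
  mdifferentiableAt_iff_differentiableAt.1
    (hF.comp (p : E) ((mdifferentiable_chart hψ).symm.mdifferentiableAt p.2))

omit [FiniteDimensional ℝ E] [IsManifold 𝓘(ℝ, E) ∞ X] [CompleteSpace E] in
/-- The manifold differential of `F ∘ Ψ` on the chart target is the Fréchet differential of the
representative `F ∘ ψ⁻¹`. [folklore] -/
theorem mvfderiv_comp_inv_toLinearMap (hψ : ψ ∈ IsManifold.maximalAtlas 𝓘(ℝ, E) ∞ X)
    (p : target ψ) {F : X → ℝ} (hF : MDifferentiableAt 𝓘(ℝ, E) 𝓘(ℝ, ℝ) F (ψ.symm p)) :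
    (mvfderiv 𝓘(ℝ, E) (F ∘ inv ψ) p : TangentSpace 𝓘(ℝ, E) p →ₗ[ℝ] ℝ) =
      ((fderiv ℝ (F ∘ ψ.symm) (p : E) : E →L[ℝ] ℝ) : E →ₗ[ℝ] ℝ) := by
  ext v
  exact OpensChart.mvfderiv_eq p (F ∘ inv ψ) (F ∘ ψ.symm) (fun _ ↦ rfl)
    (mdifferentiableAt_iff_differentiableAt.1
      (hF.comp (p : E) ((mdifferentiable_chart hψ).symm.mdifferentiableAt p.2))) v

omit [CompleteSpace E] in
/-- **`g⁻¹(dF₁, dF₂)` read in a chart of the maximal atlas**: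
`g⁻¹(dF₁, dF₂)(Ψ p) = DF̂₁(p)(♯_{G(p)} DF̂₂(p))`, `F̂ᵢ = Fᵢ ∘ ψ⁻¹`, `G = metricRepr`.
[cite: ONeill1983, Ch. 3, Prop. 3.59 and p. 60] -/
theorem innerDual_inv_eq (hψ : ψ ∈ IsManifold.maximalAtlas 𝓘(ℝ, E) ∞ X) (p : target ψ)
    {F₁ F₂ : X → ℝ} (h₁ : MDifferentiableAt 𝓘(ℝ, E) 𝓘(ℝ, ℝ) F₁ (ψ.symm p))
    (h₂ : MDifferentiableAt 𝓘(ℝ, E) 𝓘(ℝ, ℝ) F₂ (ψ.symm p)) :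
    g.innerDual (ψ.symm p)
        (mvfderiv 𝓘(ℝ, E) F₁ (ψ.symm p) : TangentSpace 𝓘(ℝ, E) (ψ.symm p) →ₗ[ℝ] ℝ)
        (mvfderiv 𝓘(ℝ, E) F₂ (ψ.symm p) : TangentSpace 𝓘(ℝ, E) (ψ.symm p) →ₗ[ℝ] ℝ) =
      fderiv ℝ (F₁ ∘ ψ.symm) p
        (MetricCoord.sharpAt (metricRepr g hψ) p (fderiv ℝ (F₂ ∘ ψ.symm) p)) := by
  have hG := metric_val_eq_repr g hψ
  have h := g.innerDual_mvfderiv_comp PseudoRiemannianMetric.contMDiff_pullbackBilin_holds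
    (contMDiff_inv hψ) (injective_mfderiv_inv hψ) rfl p (w := F₁) (v := F₂) h₁ h₂
  simp only [inv_apply] at h
  rw [← h]
  change (mvfderiv 𝓘(ℝ, E) (F₁ ∘ inv ψ) p : TangentSpace 𝓘(ℝ, E) p →ₗ[ℝ] ℝ)
      ((metric g hψ).sharp p
        (mvfderiv 𝓘(ℝ, E) (F₂ ∘ inv ψ) p : TangentSpace 𝓘(ℝ, E) p →ₗ[ℝ] ℝ)) = _
  rw [mvfderiv_comp_inv_toLinearMap hψ p h₁, mvfderiv_comp_inv_toLinearMap hψ p h₂,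
    OpensChart.sharp_eq_sharpAt hG p]
  rfl

omit [CompleteSpace E] in
/-- **`|∇F|²_g` read in a chart of the maximal atlas**: `|∇F|²(Ψ p) = gradSqAt G F̂ p`.
[cite: ONeill1983, Ch. 3, p. 85] -/
theorem gradSq_inv_eq (hψ : ψ ∈ IsManifold.maximalAtlas 𝓘(ℝ, E) ∞ X) (p : target ψ) {F : X → ℝ}
    (hF : MDifferentiableAt 𝓘(ℝ, E) 𝓘(ℝ, ℝ) F (ψ.symm p)) :
    g.gradSq F (ψ.symm p) = MetricCoord.gradSqAt (metricRepr g hψ) (F ∘ ψ.symm) p :=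
  innerDual_inv_eq g hψ p hF hF

variable [g.HasLeviCivita]

/-- **`Δ_g F` read in a chart of the maximal atlas**: `Δ_g F (Ψ p) = lapAt G F̂ p` for `F` of
class `C²` at `Ψ p`. [cite: ONeill1983, Ch. 3, Prop. 3.59] -/
theorem dalembertian_inv_eq (hψ : ψ ∈ IsManifold.maximalAtlas 𝓘(ℝ, E) ∞ X) (p : target ψ)
    {F : X → ℝ} (hF : ContMDiffAt 𝓘(ℝ, E) 𝓘(ℝ, ℝ) 2 F (ψ.symm p)) :
    g.dalembertian F (ψ.symm p) = MetricCoord.lapAt (metricRepr g hψ) (F ∘ ψ.symm) p := by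
  haveI := (metric g hψ).hasLeviCivita
  have hG := metric_val_eq_repr g hψ
  have hrep : ContDiffAt ℝ 2 (F ∘ ψ.symm) (p : E) := by
    have hsymm : ContMDiffAt 𝓘(ℝ, E) 𝓘(ℝ, E) 2 ψ.symm (p : E) :=
      ((contMDiffOn_symm_of_mem_maximalAtlas hψ).of_le (by norm_cast)).contMDiffAt
        (ψ.open_target.mem_nhds p.2)
    exact contMDiffAt_iff_contDiffAt.1 (hF.comp (p : E) hsymm)
  have h := g.dalembertian_comap PseudoRiemannianMetric.contMDiff_pullbackBilin_holds
    (contMDiff_inv hψ) (injective_mfderiv_inv hψ) rfl (u := p) (f := F) hF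
  change _ = g.dalembertian F (ψ.symm p) at h
  rw [← h]
  exact OpensChart.dalembertian_eq_lapAt hG p (fun _ ↦ rfl) hrep

/-- **The scalar curvature read in a chart of the maximal atlas**: `S_g(Ψ p) = scalAt G p`.
[cite: ONeill1983, Ch. 3, Prop. 3.59] -/
theorem scalarCurvature_inv_eq (hψ : ψ ∈ IsManifold.maximalAtlas 𝓘(ℝ, E) ∞ X) (p : target ψ) :
    g.scalarCurvature (ψ.symm p) = MetricCoord.scalAt (metricRepr g hψ) p := by
  haveI := (metric g hψ).hasLeviCivita
  rw [← OpensChart.scalarCurvature_eq_scalAt (metric_val_eq_repr g hψ) p]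
  exact (g.scalarCurvature_comap PseudoRiemannianMetric.contMDiff_pullbackBilin_holds
    (contMDiff_inv hψ) (injective_mfderiv_inv hψ) rfl p).symm

end MaxAtlasChart

end Literature.Geometry.Lorentzian

end
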